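import Literature.Computability.Complexity.SkelGenCorrect
import Literature.Computability.Complexity.SymbolPrograms
import HarnessLib

/-!
# The clause generator of the skeleton reduction, III: the machine, and Williams' Fact 3.1

Literature / circuit complexity (serves `williams_acc`). The clause function
`skAll L d = ugen (descOf d L, ·)` (`ugen_descOf`) is computed by a UNIVERSAL polynomial-time
string function (`codeFP_ugen`) after the linear-time machine that prepends the code of the
description (`prefixProg`, a structured stack program; `timeComputable_prefix`). Composing the
two (`TimeComputable.comp_holds`) gives the time bound `a · ℓᶜ + a` with the UNIVERSAL exponent
`c = max 7 k` (`k` the degree bound of the universal generator), and with the combinatorial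
fields of `SkeletonAssembly.lean` this proves the skeleton form of Williams' Fact 3.1,
`Williams2014_fact_3_1_skeleton_holds`.

## References

* R. Williams, *Nonuniform ACC circuit lower bounds*, J. ACM 61 (2014), Fact 3.1 and its proof
  sketch (p. 8) [Williams2014].
* L. Fortnow, R. Lipton, D. van Melkebeek, A. Viglas, *Time–space lower bounds for
  satisfiability*, J. ACM 52 (2005), §3.1 [FortnowEtAl2005].
* S. Arora, B. Barak, *Computational Complexity: A Modern Approach*, CUP 2009, §1.3
  [AroraBarak2009].
-/

namespace Literature.Computability.Complexity

namespace Tableau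

namespace SkelGen

open _root_.Computability CodeFP ACom

/-! ### The prefix machine -/

/-- Stores of the three registers `0` (input), `1` (output), `2` (scratch). [folklore] -/
def st (a b c : List Bool) : AStore Bool (Fin 3) := fun i => if i = 0 then a else if i = 1 then b else c

/-- `st` at the registers. [folklore] -/
@[simp] theorem st_zero (a b c : List Bool) : st a b c 0 = a := rfl
/-- `st_one` (auxiliary). [folklore] -/
@[simp] theorem st_one (a b c : List Bool) : st a b c 1 = b := rfl
/-- `st_two` (auxiliary). [folklore] -/
@[simp] theorem st_two (a b c : List Bool) : st a b c 2 = c := rfl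

/-- Updates of `st`. [folklore] -/
theorem update_st_zero (a b c a' : List Bool) : Function.update (st a b c) 0 a' = st a' b c := by
  funext i; fin_cases i <;> rfl
/-- `update_st_one` (auxiliary). [folklore] -/
theorem update_st_one (a b c b' : List Bool) : Function.update (st a b c) 1 b' = st a b' c := by
  funext i; fin_cases i <;> rfl
/-- `update_st_two` (auxiliary). [folklore] -/
theorem update_st_two (a b c c' : List Bool) : Function.update (st a b c) 2 c' = st a b c' := by
  funext i; fin_cases i <;> rfl

/-- `AStore.single` as `st`. [folklore] -/
theorem single_zero_eq (z : List Bool) : AStore.single (0 : Fin 3) z = st z [] [] := by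
  funext i; fin_cases i <;> rfl
/-- `single_one_eq` (auxiliary). [folklore] -/
theorem single_one_eq (z : List Bool) : AStore.single (1 : Fin 3) z = st [] z [] := by
  funext i; fin_cases i <;> rfl

/-- Pushing a constant word, last symbol first. [folklore] -/
def pushRev : List Bool → ACom Bool (Fin 3)
  | [] => .skip
  | a :: l => pushRev l ;; .push 1 a

/-- `pushRev p` prepends `p` to register `1` in `|p|` steps. [folklore] -/
theorem runs_pushRev (i t : List Bool) : ∀ p o : List Bool, Runs (pushRev p) (st i o t) (st i (p ++ o) t) p.length
  | [], o => by simpa [pushRev] using Runs.skip (st i o t)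
  | a :: p, o => by
    rw [pushRev, List.length_cons]
    exact (runs_pushRev i t p o).seq (Runs.push' (by rw [st_one, update_st_one]; rfl))

/-- Pouring register `0` onto register `2`. [folklore] -/
theorem runs_pour02 (o : List Bool) : ∀ z u : List Bool,
    Runs (ACom.loop 0 fun a => .push 2 a) (st z o u) (st [] o (z.reverse ++ u)) (3 * z.length + 1)
  | [], u => by simpa using Runs.loop_nil (fun a => ACom.push (2 : Fin 3) a) (R := st [] o u) rfl
  | a :: z, u => by
    have h := Runs.loop_cons' (f := fun a => ACom.push (2 : Fin 3) a) (R := st (a :: z) o u) (a := a) (w := z) rfl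
      (update_st_zero _ _ _ _) (Runs.push' (by rw [st_two, update_st_two])) (runs_pour02 o z (a :: u))
    refine h.of_eq (by simp) (by simp [List.length_cons]; omega)

/-- Pouring register `2` onto register `1`. [folklore] -/
theorem runs_pour21 (i : List Bool) : ∀ v o : List Bool,
    Runs (ACom.loop 2 fun a => .push 1 a) (st i o v) (st i (v.reverse ++ o) []) (3 * v.length + 1)
  | [], o => by simpa using Runs.loop_nil (fun a => ACom.push (1 : Fin 3) a) (R := st i o []) rfl
  | a :: v, o => by
    have h := Runs.loop_cons' (f := fun a => ACom.push (1 : Fin 3) a) (R := st i o (a :: v)) (a := a) (w := v) rfl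
      (update_st_two _ _ _ _) (Runs.push' (by rw [st_one, update_st_one])) (runs_pour21 i v (a :: o))
    refine h.of_eq (by simp) (by simp [List.length_cons]; omega)

/-- **The prefix program**: `z ↦ boolPair w z` (move the input aside and back to the output
register, then push the constant `dbl w ++ [0, 1]` on top). [folklore] -/
def prefixProg (w : List Bool) : ACom Bool (Fin 3) :=
  (ACom.loop 0 fun a => .push 2 a) ;; ((ACom.loop 2 fun a => .push 1 a) ;;
    pushRev ((w.flatMap fun b => [b, b]) ++ [false, true]))

/-- The prefix program computes `z ↦ boolPair w z` in `6|z| + 2|w| + 4` steps. [folklore] -/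
theorem runs_prefixProg (w z : List Bool) :
    Runs (prefixProg w) (AStore.single 0 z) (AStore.single 1 (boolPair w z)) (6 * z.length + 2 * w.length + 4) := by
  rw [single_zero_eq, single_one_eq, prefixProg]
  have h1 := runs_pour02 [] z []
  have h2 := runs_pour21 [] (z.reverse ++ []) []
  have h3 := runs_pushRev [] [] ((w.flatMap fun b => [b, b]) ++ [false, true]) ((z.reverse ++ []).reverse ++ [])
  refine ((h1.seq (h2.seq h3)).of_eq ?_ ?_)
  · simp [boolPair]
  · simp only [List.length_append, List.length_reverse, List.append_nil, List.length_flatMap, List.length_cons,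
      List.length_nil]
    simp only [List.map_const', List.sum_replicate, smul_eq_mul]
    omega

/-- The code of a query is `encodeSkelQuery`. [folklore] -/
theorem qE_eq (q : Query) : qE q = encodeSkelQuery q := rfl

/-- **The prefix machine**: `q ↦ (dsc, q)` from `encodeSkelQuery` to `inE` in linear time.
[cite: AroraBarak2009, §1.3] -/
theorem timeComputable_prefix (dsc : SkelExpr.Env) :
    TimeComputable encodeSkelQuery inE (fun q : Query => (dsc, q))
      (fun ℓ => 6 * ℓ + (2 * (SkelExpr.envE dsc).length + 5)) := by
  obtain ⟨M, hM⟩ := ACom.exists_computesInTime (prefixProg (SkelExpr.envE dsc)) (0 : Fin 3) 1 encodeSkelQuery inE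
    (fun q : Query => (dsc, q)) (fun q => 6 * (encodeSkelQuery q).length + 2 * (SkelExpr.envE dsc).length + 4)
    (fun q => by
      have h := runs_prefixProg (SkelExpr.envE dsc) (encodeSkelQuery q)
      exact h)
  exact ⟨M, fun q => (hM q).mono (by dsimp only; omega)⟩

/-! ### Exponent bookkeeping -/

/-- `(ℓ + B)ᵏ ≤ (B + 1)ᵏ (3ᵏ ℓᵏ + 1)`. [folklore] -/
theorem add_pow_le (ℓ B k : ℕ) : (ℓ + B) ^ k ≤ (B + 1) ^ k * (3 ^ k * ℓ ^ k + 1) := by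
  calc (ℓ + B) ^ k ≤ ((B + 1) * (2 * ℓ + 1)) ^ k := Nat.pow_le_pow_left (by nlinarith) k
    _ = (B + 1) ^ k * (2 * ℓ + 1) ^ k := mul_pow _ _ _
    _ ≤ (B + 1) ^ k * (3 ^ k * ℓ ^ k + 1) := Nat.mul_le_mul_left _ (two_mul_add_one_pow_le ℓ k)

/-! ### Williams' Fact 3.1 in skeleton form -/

/-- `encodingClause` codes by `clE`. [folklore] -/
theorem encodingClause_eq : (encodingClause.encode : Clause ℕ → List Bool) = clE := listE_eq encodingLiteral

/-- **Williams 2014, Fact 3.1 (skeleton form), proved.** There is a universal `c` such that every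
`L ∈ NTIME[2ⁿ]` has a skeleton reduction to `3SAT` with constant `c`: clauses of width `3`
over `2^{n + c log n + c}` variables, the `i`-th clause computable from `⟨1ⁿ, ⟨bin i, xᵢ⟩⟩` in
time `a ℓᶜ + a`, and `x ∈ L` iff the instantiated formula is satisfiable. The skeleton is
`skAll L d` (table mode below `N₀`, the quasi-linear sorting-network tableau above); the
machine is the universal generator `ugen` run after the prefix machine of the description of
the verifier; `c = max 7 k` with `k` the degree of the universal generator.
[cite: Williams2014, Fact 3.1 and proof sketch (p. 8)] -/
theorem fact_3_1_skeleton_holds : Williams2014_fact_3_1_skeleton := by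
  classical
  -- the universal generator and its degree
  obtain ⟨fU, ⟨pU, MU, hMU⟩, hUf⟩ := codeFP_ugen
  obtain ⟨cU, kU, hkU⟩ := exists_eval_le_mul_pow_add pU
  have hg : TimeComputable inE clE ugen (fun ℓ => cU * ℓ ^ kU + cU) := by
    refine ⟨MU, fun a => ?_⟩
    have h := hMU (inE a)
    simp only [id] at h
    rw [hUf] at h
    exact h.mono (hkU _)
  have hmono : Monotone fun ℓ : ℕ => cU * ℓ ^ kU + cU := fun m m' hmm' => by dsimp only; gcongr
  refine ⟨max 7 kU, fun L hL => ?_⟩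
  have hc7 : 7 ≤ max 7 kU := le_max_left _ _
  obtain ⟨d, R, hR, hLR⟩ := exists_skData hL
  refine ⟨skAll L d, ⟨fun n i b => length_skAll_le n i b, fun n i b => vars_skAll_lt hc7 n i b,
    fun n i b hi => skAll_taut hc7 hi b, ?_, fun x => mem_iff_skAll hR hLR hc7 x⟩⟩
  -- the machine: prefix, then the universal generator
  set B := (SkelExpr.envE (descOf d L)).length with hB
  have hf := timeComputable_prefix (descOf d L)
  have hs : ∀ q : Query, (inE (descOf d L, q)).length ≤ (encodeSkelQuery q).length + (2 * B + 2) := by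
    intro q
    show (boolPair (SkelExpr.envE (descOf d L)) (qE q)).length ≤ _
    rw [length_boolPair, qE_eq]; omega
  have hcomp := @TimeComputable.comp_holds Query (SkelExpr.Env × Query) (Clause ℕ) Bool Bool Bool
  unfold TimeComputable.comp at hcomp
  obtain ⟨C, hC⟩ := @hcomp encodeSkelQuery inE clE (fun q : Query => (descOf d L, q)) ugen
    (fun ℓ => 6 * ℓ + (2 * B + 5)) (fun ℓ => cU * ℓ ^ kU + cU) (fun ℓ => ℓ + (2 * B + 2)) hg hf hmono hs
  -- the composite is the skeleton
  have hfun : (ugen ∘ fun q : Query => (descOf d L, q)) = fun q : Query => skAll L d q.1 q.2.1 q.2.2 := by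
    funext q; obtain ⟨n, i, b⟩ := q; rw [Function.comp_apply]; exact ugen_descOf n i b
  rw [hfun] at hC
  suffices hfin : ∃ a, TimeComputable encodeSkelQuery clE (fun q : Query => skAll L d q.1 q.2.1 q.2.2)
      fun ℓ => a * ℓ ^ max 7 kU + a by
    rw [encodingClause_eq]; exact hfin
  -- the time bound
  set c := max 7 kU with hcdef
  have hkc : kU ≤ c := le_max_right _ _
  set E := cU * (2 * B + 3) ^ kU * 3 ^ kU + cU * (2 * B + 3) ^ kU + cU with hE
  set G := 6 + (2 * B + 5) + E + (1 + (2 * B + 2)) with hG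
  refine ⟨C * G + C, hC.mono fun ℓ => ?_⟩
  have hℓ : ℓ ≤ ℓ ^ c + 1 := by simpa using pow_le_pow_add_one_of_le ℓ (show 1 ≤ c by omega)
  have hk : ℓ ^ kU ≤ ℓ ^ c + 1 := pow_le_pow_add_one_of_le ℓ hkc
  have hpos : 0 < ℓ ^ c + 1 := Nat.succ_pos _
  have h1 : 6 * ℓ + (2 * B + 5) ≤ (6 + (2 * B + 5)) * (ℓ ^ c + 1) :=
    calc 6 * ℓ + (2 * B + 5) ≤ 6 * (ℓ ^ c + 1) + (2 * B + 5) * (ℓ ^ c + 1) :=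
          Nat.add_le_add (Nat.mul_le_mul_left 6 hℓ) (Nat.le_mul_of_pos_right _ hpos)
      _ = (6 + (2 * B + 5)) * (ℓ ^ c + 1) := by ring
  have h2 : cU * (ℓ + (2 * B + 2)) ^ kU + cU ≤ E * (ℓ ^ c + 1) := by
    have h := add_pow_le ℓ (2 * B + 2) kU
    have h' : (2 * B + 2 + 1) = 2 * B + 3 := by ring
    rw [h'] at h
    calc cU * (ℓ + (2 * B + 2)) ^ kU + cU ≤ cU * ((2 * B + 3) ^ kU * (3 ^ kU * ℓ ^ kU + 1)) + cU :=
          by gcongr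
      _ = cU * (2 * B + 3) ^ kU * 3 ^ kU * ℓ ^ kU + cU * (2 * B + 3) ^ kU + cU := by ring
      _ ≤ cU * (2 * B + 3) ^ kU * 3 ^ kU * (ℓ ^ c + 1) + cU * (2 * B + 3) ^ kU * (ℓ ^ c + 1) + cU * (ℓ ^ c + 1) :=
          Nat.add_le_add (Nat.add_le_add (Nat.mul_le_mul_left _ hk) (Nat.le_mul_of_pos_right _ hpos))
            (Nat.le_mul_of_pos_right _ hpos)
      _ = E * (ℓ ^ c + 1) := by rw [hE]; ring
  have h3 : ℓ + (2 * B + 2) ≤ (1 + (2 * B + 2)) * (ℓ ^ c + 1) :=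
    calc ℓ + (2 * B + 2) ≤ 1 * (ℓ ^ c + 1) + (2 * B + 2) * (ℓ ^ c + 1) :=
          Nat.add_le_add (by simpa using hℓ) (Nat.le_mul_of_pos_right _ hpos)
      _ = (1 + (2 * B + 2)) * (ℓ ^ c + 1) := by ring
  calc C * (6 * ℓ + (2 * B + 5) + (cU * (ℓ + (2 * B + 2)) ^ kU + cU) + (ℓ + (2 * B + 2))) + C
      ≤ C * ((6 + (2 * B + 5)) * (ℓ ^ c + 1) + E * (ℓ ^ c + 1) + (1 + (2 * B + 2)) * (ℓ ^ c + 1)) + C := by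
        gcongr
    _ = (C * G) * ℓ ^ c + (C * G + C) := by rw [hG]; ring
    _ ≤ (C * G + C) * ℓ ^ c + (C * G + C) := by gcongr; omega

end SkelGen

end Tableau

/-- **Williams 2014, Fact 3.1 in skeleton form** — the named fact
`Williams2014_fact_3_1_skeleton` of `SuccinctSkeletonReductions.lean` holds.
[cite: Williams2014, Fact 3.1 and proof sketch (p. 8)] -/
theorem Williams2014_fact_3_1_skeleton_holds : Williams2014_fact_3_1_skeleton :=
  Tableau.SkelGen.fact_3_1_skeleton_holds

end Literature.Computability.Complexity
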